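import Summits.Ventures.Crystal3D.Statement
import Summits.Ventures.Crystal3D.StickySpheres.D3Pieces
import HarnessLib

/-!
# Bezdek's octahedra for every `k`: `6N − ∛486 · N^{2/3} < C(N)` at `N = k(2k²+1)/3`

HONEST FRAMING. Part of the venture `Summits/Ventures/Crystal3D` (cell `pub-crystal3d`; seat p3).
CONSTRUCTION side only: this file PROVES the venture Prop `OctahedralLowerBound` of
`Statement.lean` — Bezdek 2012 (DCG 48), Theorem 1.1 (iii): for every `k ≥ 2` and
`N = k(2k²+1)/3`, `6N − ∛486 · N^{2/3} < C(N) = maxContacts 3 N` — for ALL `k`, closing the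
`TODO(general form)` of `Literature/Geometry/DiscreteGeometry/ContactNumberBounds.lean` (which has
the instances `k = 2, 3, 4` by `decide`). Nothing is claimed about upper bounds, ground states or
crystallization; no number of the cell moves.

## The construction (as printed, Bezdek 2012, proof of Thm 1.1 (iii): "the `n(k) = (2k³+k)/3`
## points of the face-centred cubic lattice in a regular octahedron with `k` lattice points along
## each edge carry `C = 4k³ − 6k² + 2k = 6 n(k) − 6k²` contacts")

Integer model in one parity class of `ℤ³` (a translate of `D₃`; contact = squared distance `2`,
scale `1/√2`, substrate `StickySpheres/D3Pieces.lean`), with `r = k − 1`: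
`fccOctahedronInt r = {v ∈ ℤ³ : |v₀| + |v₁| + |v₂| ≤ r, v₀ + v₁ + v₂ ≡ r (mod 2)}` — the lattice
points of the regular octahedron of `ℓ¹`-radius `r`; its horizontal sections `v₂ = t` are
`45°`-rotated square grids of side `r − |t| + 1` (`layerPts`), i.e. the square layers
`1², 2², …, k², …, 2², 1²` of the octahedral cluster.

* `card = N`: the octahedron is the disjoint union of its layers (`fccOctahedronInt_eq_layers`)
  and `∑ (r−|t|+1)² = k(2k²+1)/3` (`three_mul_octLayerSum`, `card_fccOctahedronInt`).
* contacts `≥ 4k³ − 6k² + 2k = 2r(r+1)(2r+1)`: twice the contact number is at least the sum over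
  the twelve minimal vectors `δ` of `#{v ∈ S : v + δ ∈ S}` (`D3Pieces`); for `δ = (1,1,0)` the
  explicit sub-family `octShiftFamily r` (grid points with a grid neighbour in the same layer) has
  `r(r+1)(2r+1)/3` members, and the other eleven directions follow by transporting this count along
  the coordinate symmetries `swap01`, `swap12`, `neg1` of the octahedron.
* the printed inequality from the integer certificate `C + 6k² = 6N`, `(6k²)³ < 486 N²`
  (`six_mul_sub_rpow_lt_of_cube`).

Main results: `card_fccOctahedronInt : card = octahedralNumber (r+1)`,
`le_maxContacts_octahedralNumber : 4k³ − 6k² + 2k ≤ C(k(2k²+1)/3)` (stated with `k = r + 1` as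
`2r(r+1)(2r+1) ≤ …`) and `octahedralLowerBound_holds : OctahedralLowerBound`. Standard axioms only.

References: K. Bezdek, Contact numbers for congruent sphere packings in Euclidean 3-space, Discrete
Comput. Geom. 48 (2012) 298–309, Theorem 1.1 (iii) and its proof (bib keys `Bezdek2011`/`Bezdek2012`).
-/

noncomputable section

open scoped BigOperators
open Finset

namespace Summit.Ventures.Crystal3D

/-! ## Bezdek's octahedron as an integer model -/

/-- **Bezdek's octahedron `𝒫_fcc(k)`, `k = r + 1`, integer model**: the vectors `v ∈ ℤ³` with
`|v₀| + |v₁| + |v₂| ≤ r` and `v₀ + v₁ + v₂ ≡ r (mod 2)` — the points of one parity class of `ℤ³`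
(a translate of `D₃`) in the regular octahedron of `ℓ¹`-radius `r`, `k` lattice points along each
edge; nearest neighbours at squared distance `2`. (A filter of the cube `[-r, r]³`, so that the
coordinate symmetries act on it visibly.) -/
def fccOctahedronInt (r : ℕ) : Finset (Fin 3 → ℤ) :=
  (Fintype.piFinset fun _ : Fin 3 => Icc (-(r : ℤ)) r).filter
    fun v => |v 0| + |v 1| + |v 2| ≤ r ∧ (2 : ℤ) ∣ v 0 + v 1 + v 2 - r

/-- Membership in the octahedron: the `ℓ¹` bound and the parity condition (the cube bounds are
implied). -/
theorem mem_fccOctahedronInt {r : ℕ} {v : Fin 3 → ℤ} :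
    v ∈ fccOctahedronInt r ↔ |v 0| + |v 1| + |v 2| ≤ r ∧ (2 : ℤ) ∣ v 0 + v 1 + v 2 - r := by
  rw [fccOctahedronInt, mem_filter, Fintype.mem_piFinset]
  refine ⟨fun h => h.2, fun h => ⟨fun k => mem_Icc.2 (abs_le.1 (le_trans ?_ h.1)), h⟩⟩
  simpa only [Fin.sum_univ_three] using
    Finset.single_le_sum (f := fun i => |v i|) (fun i _ => abs_nonneg (v i)) (mem_univ k)

/-- All points of the octahedron lie in one parity class of coordinate sums. -/
theorem fccOctahedronInt_parity (r : ℕ) :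
    ∀ v ∈ fccOctahedronInt r, ∀ w ∈ fccOctahedronInt r,
      (2 : ℤ) ∣ v 0 + v 1 + v 2 - (w 0 + w 1 + w 2) := by
  intro v hv w hw
  have h1 := (mem_fccOctahedronInt.1 hv).2
  have h2 := (mem_fccOctahedronInt.1 hw).2
  omega

/-- The octahedron is invariant under the swap of the first two coordinates. -/
theorem swap01_mem_fccOctahedronInt {r : ℕ} {v : Fin 3 → ℤ} (hv : v ∈ fccOctahedronInt r) :
    swap01 v ∈ fccOctahedronInt r := by
  rw [mem_fccOctahedronInt] at hv ⊢
  simp only [swap01, Matrix.cons_val_zero, Matrix.cons_val_one, Matrix.cons_val_two,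
    Matrix.head_cons, Matrix.tail_cons]
  omega

/-- The octahedron is invariant under the swap of the last two coordinates. -/
theorem swap12_mem_fccOctahedronInt {r : ℕ} {v : Fin 3 → ℤ} (hv : v ∈ fccOctahedronInt r) :
    swap12 v ∈ fccOctahedronInt r := by
  rw [mem_fccOctahedronInt] at hv ⊢
  simp only [swap12, Matrix.cons_val_zero, Matrix.cons_val_one, Matrix.cons_val_two,
    Matrix.head_cons, Matrix.tail_cons]
  omega

/-- The octahedron is invariant under the sign change of the middle coordinate. -/
theorem neg1_mem_fccOctahedronInt {r : ℕ} {v : Fin 3 → ℤ} (hv : v ∈ fccOctahedronInt r) :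
    neg1 v ∈ fccOctahedronInt r := by
  rw [mem_fccOctahedronInt] at hv ⊢
  simp only [neg1, Matrix.cons_val_zero, Matrix.cons_val_one, Matrix.cons_val_two,
    Matrix.head_cons, Matrix.tail_cons, abs_neg]
  omega

/-- **The octahedral fcc piece** `𝒫_fcc(r+1)` as a packing of diameter-`1` balls
(`card (fccOctahedronInt r) = octahedralNumber (r + 1)` of them, `card_fccOctahedronInt`). -/
def fccOctahedronConfig (r : ℕ) : Fin (fccOctahedronInt r).card → EuclideanSpace ℝ (Fin 3) :=
  d3Config (fccOctahedronInt r)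

/-- The octahedral piece is a unit packing. -/
theorem isUnitPacking_fccOctahedronConfig (r : ℕ) : IsUnitPacking (fccOctahedronConfig r) :=
  isUnitPacking_d3Config (fccOctahedronInt_parity r)

/-- **Layer points lie in the octahedron**: at height `t = ±(r − m)`, every grid point
`layerPt m t (i, j)` with `i, j ≤ m` belongs to `fccOctahedronInt r`. -/
theorem layerPt_mem_fccOctahedronInt {r m i j : ℕ} {t : ℤ} (hm : m ≤ r)
    (ht : t = (r : ℤ) - m ∨ t = -((r : ℤ) - m)) (hi : i ≤ m) (hj : j ≤ m) :
    layerPt m t (i, j) ∈ fccOctahedronInt r := by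
  rw [mem_fccOctahedronInt]
  simp only [layerPt, Matrix.cons_val_zero, Matrix.cons_val_one, Matrix.cons_val_two,
    Matrix.head_cons, Matrix.tail_cons]
  have hi' : (i : ℤ) ≤ m := (by exact_mod_cast hi); have hj' : (j : ℤ) ≤ m := (by exact_mod_cast hj)
  have hm' : (m : ℤ) ≤ r := by exact_mod_cast hm
  rcases abs_cases ((i : ℤ) - j) with ⟨ha, _⟩ | ⟨ha, _⟩ <;>
    rcases abs_cases ((i : ℤ) + j - m) with ⟨hb, _⟩ | ⟨hb, _⟩ <;>
      rcases ht with rfl | rfl <;>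
        rcases abs_cases ((r : ℤ) - m) with ⟨hc, _⟩ | ⟨hc, _⟩ <;>
          rcases abs_cases (-((r : ℤ) - m)) with ⟨hd, _⟩ | ⟨hd, _⟩ <;>
            refine ⟨?_, ?_⟩ <;> omega

/-- **The octahedron is covered by its layers**: heights `t = r − m` (`0 ≤ m ≤ r`) and
`t = −(r − m)` (`0 ≤ m < r`), each carrying the grid of side `m + 1`. -/
theorem fccOctahedronInt_subset_layers (r : ℕ) :
    fccOctahedronInt r ⊆
      (range (r + 1)).biUnion (fun m => layerPts (m + 1) (m + 1) m ((r : ℤ) - m)) ∪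
        (range r).biUnion (fun m => layerPts (m + 1) (m + 1) m (-((r : ℤ) - m))) := by
  intro v hv
  obtain ⟨h1, hpar⟩ := mem_fccOctahedronInt.1 hv
  have a0 := le_abs_self (v 0); have b0 := neg_abs_le (v 0); have a1 := le_abs_self (v 1)
  have b1 := neg_abs_le (v 1)
  rcases le_or_gt 0 (v 2) with h2 | h2
  · have habs : |v 2| = v 2 := abs_of_nonneg h2
    obtain ⟨m, hm⟩ := Int.eq_ofNat_of_zero_le (show (0 : ℤ) ≤ r - v 2 by omega)
    obtain ⟨i, hi⟩ := Int.eq_ofNat_of_zero_le (show (0 : ℤ) ≤ (v 0 + v 1 + m) / 2 by omega)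
    obtain ⟨j, hj⟩ := Int.eq_ofNat_of_zero_le (show (0 : ℤ) ≤ (v 1 - v 0 + m) / 2 by omega)
    refine mem_union_left _ (mem_biUnion.2 ⟨m, mem_range.2 (by omega), ?_⟩)
    refine mem_layerPts.2 ⟨i, j, by omega, by omega, ?_⟩
    ext k; fin_cases k
    · show (i : ℤ) - j = v 0; omega
    · show (i : ℤ) + j - m = v 1; omega
    · show (r : ℤ) - m = v 2; omega
  · have habs : |v 2| = -v 2 := abs_of_neg h2
    obtain ⟨m, hm⟩ := Int.eq_ofNat_of_zero_le (show (0 : ℤ) ≤ r + v 2 by omega)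
    obtain ⟨i, hi⟩ := Int.eq_ofNat_of_zero_le (show (0 : ℤ) ≤ (v 0 + v 1 + m) / 2 by omega)
    obtain ⟨j, hj⟩ := Int.eq_ofNat_of_zero_le (show (0 : ℤ) ≤ (v 1 - v 0 + m) / 2 by omega)
    refine mem_union_right _ (mem_biUnion.2 ⟨m, mem_range.2 (by omega), ?_⟩)
    refine mem_layerPts.2 ⟨i, j, by omega, by omega, ?_⟩
    ext k; fin_cases k
    · show (i : ℤ) - j = v 0; omega
    · show (i : ℤ) + j - m = v 1; omega
    · show -((r : ℤ) - m) = v 2; omega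

/-- `3 · (∑_{m ≤ r} (m+1)² + ∑_{m < r} (m+1)²) = (r+1)(2(r+1)² + 1)`: the layers `1², …, k², …, 1²`
of `𝒫_fcc(k)` have `k(2k²+1)/3` points in total (`k = r + 1`). -/
theorem three_mul_octLayerSum (r : ℕ) :
    3 * (∑ m ∈ range (r + 1), (m + 1) * (m + 1) + ∑ m ∈ range r, (m + 1) * (m + 1)) =
      (r + 1) * (2 * (r + 1) ^ 2 + 1) := by
  induction r with
  | zero => simp
  | succ n ih =>
    rw [sum_range_succ _ n] at ih
    rw [sum_range_succ _ (n + 1), sum_range_succ _ n]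
    nlinarith [ih]

/-- **The octahedron is the union of its layers** (conversely every layer point lies in it). -/
theorem fccOctahedronInt_eq_layers (r : ℕ) :
    fccOctahedronInt r =
      (range (r + 1)).biUnion (fun m => layerPts (m + 1) (m + 1) m ((r : ℤ) - m)) ∪
        (range r).biUnion (fun m => layerPts (m + 1) (m + 1) m (-((r : ℤ) - m))) := by
  refine Subset.antisymm (fccOctahedronInt_subset_layers r) ?_
  intro v hv
  rcases mem_union.1 hv with h | h
  · obtain ⟨m, hm, hv⟩ := mem_biUnion.1 h
    obtain ⟨i, j, hi, hj, rfl⟩ := mem_layerPts.1 hv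
    have hm' : m ≤ r := by simp at hm; omega
    exact layerPt_mem_fccOctahedronInt hm' (Or.inl rfl) (by omega) (by omega)
  · obtain ⟨m, hm, hv⟩ := mem_biUnion.1 h
    obtain ⟨i, j, hi, hj, rfl⟩ := mem_layerPts.1 hv
    have hm' : m ≤ r := by simp at hm; omega
    exact layerPt_mem_fccOctahedronInt hm' (Or.inr rfl) (by omega) (by omega)

/-- `octahedralNumber (r+1) = ∑_{m ≤ r} (m+1)² + ∑_{m < r} (m+1)²` (the `ℕ`-division in
`octahedralNumber` is exact). -/
theorem octahedralNumber_succ_eq_layerSum (r : ℕ) :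
    octahedralNumber (r + 1) =
      ∑ m ∈ range (r + 1), (m + 1) * (m + 1) + ∑ m ∈ range r, (m + 1) * (m + 1) := by
  unfold octahedralNumber
  rw [← three_mul_octLayerSum, Nat.mul_div_cancel_left _ (by norm_num : 0 < 3)]

/-- **Exactly `k(2k²+1)/3` balls**: `card (fccOctahedronInt r) = octahedralNumber (r + 1)` — the
`n(k)` of Bezdek's `𝒫_fcc(k)`, `k = r + 1`. -/
theorem card_fccOctahedronInt (r : ℕ) :
    (fccOctahedronInt r).card = octahedralNumber (r + 1) := by
  rw [octahedralNumber_succ_eq_layerSum, fccOctahedronInt_eq_layers, card_union_of_disjoint,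
    card_biUnion, card_biUnion]
  · simp only [card_layerPts]
  · intro m hm m' hm' hne
    exact disjoint_layerPts (by simp at hm hm'; omega)
  · intro m hm m' hm' hne
    exact disjoint_layerPts (by simp at hm hm'; omega)
  · rw [disjoint_biUnion_left]
    intro m hm
    rw [disjoint_biUnion_right]
    intro m' hm'
    exact disjoint_layerPts (by simp at hm hm'; omega)

/-! ## Lattice contacts in the direction `(1, 1, 0)` -/

/-- The grid points with a grid neighbour `i ↦ i + 1` in the same layer: `layerPt m t (i, j)` with
`i < m`, `j ≤ m`, over all layers of the octahedron. -/
def octShiftFamily (r : ℕ) : Finset (Fin 3 → ℤ) :=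
  (range (r + 1)).biUnion (fun m => layerPts m (m + 1) m ((r : ℤ) - m)) ∪
    (range r).biUnion (fun m => layerPts m (m + 1) m (-((r : ℤ) - m)))

/-- `3 · (∑_{m ≤ r} m(m+1) + ∑_{m < r} m(m+1)) = r(r+1)(2r+1)`. -/
theorem three_mul_octShiftSum (r : ℕ) :
    3 * (∑ m ∈ range (r + 1), m * (m + 1) + ∑ m ∈ range r, m * (m + 1)) =
      r * (r + 1) * (2 * r + 1) := by
  induction r with
  | zero => simp
  | succ n ih =>
    rw [sum_range_succ _ n] at ih
    rw [sum_range_succ _ (n + 1), sum_range_succ _ n]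
    nlinarith [ih]

/-- The family has `r(r+1)(2r+1)/3` members (layers at different heights are disjoint). -/
theorem three_mul_card_octShiftFamily (r : ℕ) :
    3 * (octShiftFamily r).card = r * (r + 1) * (2 * r + 1) := by
  rw [← three_mul_octShiftSum, octShiftFamily, card_union_of_disjoint, card_biUnion, card_biUnion]
  · simp only [card_layerPts]
  · intro m hm m' hm' hne
    exact disjoint_layerPts (by simp at hm hm'; omega)
  · intro m hm m' hm' hne
    exact disjoint_layerPts (by simp at hm hm'; omega)
  · rw [disjoint_biUnion_left]
    intro m hm
    rw [disjoint_biUnion_right]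
    intro m' hm'
    exact disjoint_layerPts (by simp at hm hm'; omega)

/-- The family lies in the octahedron. -/
theorem octShiftFamily_subset (r : ℕ) : octShiftFamily r ⊆ fccOctahedronInt r := by
  intro v hv
  rcases mem_union.1 hv with h | h
  · obtain ⟨m, hm, hv⟩ := mem_biUnion.1 h
    obtain ⟨i, j, hi, hj, rfl⟩ := mem_layerPts.1 hv
    have hm' : m ≤ r := by simp at hm; omega
    exact layerPt_mem_fccOctahedronInt hm' (Or.inl rfl) hi.le (by omega)
  · obtain ⟨m, hm, hv⟩ := mem_biUnion.1 h
    obtain ⟨i, j, hi, hj, rfl⟩ := mem_layerPts.1 hv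
    have hm' : m ≤ r := by simp at hm; omega
    exact layerPt_mem_fccOctahedronInt hm' (Or.inr rfl) hi.le (by omega)

/-- The grid neighbour `i ↦ i + 1` is the lattice neighbour in direction `(1, 1, 0)`. -/
theorem layerPt_add_oneOneZero (m t : ℤ) (i j : ℕ) :
    layerPt m t (i, j) + ![1, 1, 0] = layerPt m t (i + 1, j) := by
  ext k; fin_cases k <;> simp [layerPt] <;> ring

/-- Shifting the family by `(1, 1, 0)` stays inside the octahedron. -/
theorem octShiftFamily_shift_subset (r : ℕ) :
    ∀ v ∈ octShiftFamily r, v + ![1, 1, 0] ∈ fccOctahedronInt r := by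
  intro v hv
  rcases mem_union.1 hv with h | h
  · obtain ⟨m, hm, hv⟩ := mem_biUnion.1 h
    obtain ⟨i, j, hi, hj, rfl⟩ := mem_layerPts.1 hv
    have hm' : m ≤ r := by simp at hm; omega
    rw [layerPt_add_oneOneZero]
    exact layerPt_mem_fccOctahedronInt hm' (Or.inl rfl) (by omega) (by omega)
  · obtain ⟨m, hm, hv⟩ := mem_biUnion.1 h
    obtain ⟨i, j, hi, hj, rfl⟩ := mem_layerPts.1 hv
    have hm' : m ≤ r := by simp at hm; omega
    rw [layerPt_add_oneOneZero]
    exact layerPt_mem_fccOctahedronInt hm' (Or.inr rfl) (by omega) (by omega)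

/-- **The base count**: at least `card (octShiftFamily r)` lattice contacts in direction
`(1, 1, 0)`. -/
theorem card_octShiftFamily_le_shiftCount (r : ℕ) :
    (octShiftFamily r).card ≤ shiftCount (fccOctahedronInt r) ![1, 1, 0] :=
  card_le_card fun v hv =>
    mem_filter.2 ⟨octShiftFamily_subset r hv, octShiftFamily_shift_subset r v hv⟩

/-- **All twelve directions**: by the symmetries `swap01`, `swap12`, `neg1` of the octahedron, every
minimal vector of `D₃` carries at least `card (octShiftFamily r)` lattice contacts. -/
theorem card_octShiftFamily_le_shiftCount_of_mem (r : ℕ) :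
    ∀ δ ∈ d3Offsets, (octShiftFamily r).card ≤ shiftCount (fccOctahedronInt r) δ := by
  have s01 : ∀ δ, shiftCount (fccOctahedronInt r) δ ≤ shiftCount (fccOctahedronInt r) (swap01 δ) :=
    shiftCount_le_of_map swap01_add swap01_injective (fun v hv => swap01_mem_fccOctahedronInt hv)
  have s12 : ∀ δ, shiftCount (fccOctahedronInt r) δ ≤ shiftCount (fccOctahedronInt r) (swap12 δ) :=
    shiftCount_le_of_map swap12_add swap12_injective (fun v hv => swap12_mem_fccOctahedronInt hv)
  have n1 : ∀ δ, shiftCount (fccOctahedronInt r) δ ≤ shiftCount (fccOctahedronInt r) (neg1 δ) :=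
    shiftCount_le_of_map neg1_add neg1_injective (fun v hv => neg1_mem_fccOctahedronInt hv)
  have h1 : (octShiftFamily r).card ≤ shiftCount (fccOctahedronInt r) ![1, 1, 0] :=
    card_octShiftFamily_le_shiftCount r
  have h2 : (octShiftFamily r).card ≤ shiftCount (fccOctahedronInt r) ![1, -1, 0] := by
    have := h1.trans (n1 _); rwa [show neg1 ![1, 1, 0] = ![1, -1, 0] by ext k; fin_cases k <;> rfl] at this
  have h3 : (octShiftFamily r).card ≤ shiftCount (fccOctahedronInt r) ![-1, 1, 0] := by
    have := h2.trans (s01 _); rwa [show swap01 ![1, -1, 0] = ![-1, 1, 0] by ext k; fin_cases k <;> rfl] at this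
  have h4 : (octShiftFamily r).card ≤ shiftCount (fccOctahedronInt r) ![-1, -1, 0] := by
    have := h3.trans (n1 _); rwa [show neg1 ![-1, 1, 0] = ![-1, -1, 0] by ext k; fin_cases k <;> rfl] at this
  have h5 : (octShiftFamily r).card ≤ shiftCount (fccOctahedronInt r) ![1, 0, 1] := by
    have := h1.trans (s12 _); rwa [show swap12 ![1, 1, 0] = ![1, 0, 1] by ext k; fin_cases k <;> rfl] at this
  have h6 : (octShiftFamily r).card ≤ shiftCount (fccOctahedronInt r) ![1, 0, -1] := by
    have := h2.trans (s12 _); rwa [show swap12 ![1, -1, 0] = ![1, 0, -1] by ext k; fin_cases k <;> rfl] at this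
  have h7 : (octShiftFamily r).card ≤ shiftCount (fccOctahedronInt r) ![-1, 0, 1] := by
    have := h3.trans (s12 _); rwa [show swap12 ![-1, 1, 0] = ![-1, 0, 1] by ext k; fin_cases k <;> rfl] at this
  have h8 : (octShiftFamily r).card ≤ shiftCount (fccOctahedronInt r) ![-1, 0, -1] := by
    have := h4.trans (s12 _); rwa [show swap12 ![-1, -1, 0] = ![-1, 0, -1] by ext k; fin_cases k <;> rfl] at this
  have h9 : (octShiftFamily r).card ≤ shiftCount (fccOctahedronInt r) ![0, 1, 1] := by
    have := h5.trans (s01 _); rwa [show swap01 ![1, 0, 1] = ![0, 1, 1] by ext k; fin_cases k <;> rfl] at this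
  have h10 : (octShiftFamily r).card ≤ shiftCount (fccOctahedronInt r) ![0, 1, -1] := by
    have := h6.trans (s01 _); rwa [show swap01 ![1, 0, -1] = ![0, 1, -1] by ext k; fin_cases k <;> rfl] at this
  have h11 : (octShiftFamily r).card ≤ shiftCount (fccOctahedronInt r) ![0, -1, 1] := by
    have := h7.trans (s01 _); rwa [show swap01 ![-1, 0, 1] = ![0, -1, 1] by ext k; fin_cases k <;> rfl] at this
  have h12 : (octShiftFamily r).card ≤ shiftCount (fccOctahedronInt r) ![0, -1, -1] := by
    have := h8.trans (s01 _); rwa [show swap01 ![-1, 0, -1] = ![0, -1, -1] by ext k; fin_cases k <;> rfl] at this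
  intro δ hδ
  simp only [d3Offsets, mem_insert, mem_singleton] at hδ
  rcases hδ with rfl | rfl | rfl | rfl | rfl | rfl | rfl | rfl | rfl | rfl | rfl | rfl
  exacts [h1, h2, h3, h4, h5, h6, h7, h8, h9, h10, h11, h12]

/-! ## The contact number of the octahedral piece and Bezdek's inequality -/

/-- **Contacts of `𝒫_fcc(k)`**: the octahedral piece with `k = r + 1` balls per edge has at least
`2r(r+1)(2r+1) = 4k³ − 6k² + 2k` contacts (Bezdek: exactly that many). -/
theorem le_numContacts_fccOctahedronConfig (r : ℕ) :
    2 * (r * (r + 1) * (2 * r + 1)) ≤ numContacts (fccOctahedronConfig r) := by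
  have hsum := sum_shiftCount_le_two_mul_numContacts (S := fccOctahedronInt r)
  have h12 : 12 * (octShiftFamily r).card ≤ ∑ δ ∈ d3Offsets, shiftCount (fccOctahedronInt r) δ :=
    calc 12 * (octShiftFamily r).card = ∑ δ ∈ d3Offsets, (octShiftFamily r).card := by
          rw [sum_const, card_d3Offsets, smul_eq_mul]
      _ ≤ _ := sum_le_sum (card_octShiftFamily_le_shiftCount_of_mem r)
  have h3 := three_mul_card_octShiftFamily r
  rw [fccOctahedronConfig]
  omega

/-- **Bezdek's contact count transported to `C(N)`**: with `k = r + 1` and `N = k(2k²+1)/3`,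
`4k³ − 6k² + 2k = 2r(r+1)(2r+1) ≤ C(N) = maxContacts 3 (octahedralNumber k)`. -/
theorem le_maxContacts_octahedralNumber (r : ℕ) :
    2 * (r * (r + 1) * (2 * r + 1)) ≤ maxContacts 3 (octahedralNumber (r + 1)) := by
  rw [← card_fccOctahedronInt]
  exact (le_numContacts_fccOctahedronConfig r).trans
    (numContacts_le_maxContacts (isUnitPacking_fccOctahedronConfig r))

/-- `6n − ∛486 · n^{2/3} < C` from an integer certificate `C + D = 6n`, `D³ < 486 n²`. -/
theorem six_mul_sub_rpow_lt_of_cube {n C D : ℕ} (hCD : C + D = 6 * n) (h : D ^ 3 < 486 * n ^ 2) :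
    (6 * n : ℝ) - (486 : ℝ) ^ ((1 : ℝ) / 3) * (n : ℝ) ^ ((2 : ℝ) / 3) < C := by
  have hX : (0 : ℝ) ≤ (486 : ℝ) ^ ((1 : ℝ) / 3) * (n : ℝ) ^ ((2 : ℝ) / 3) := by positivity
  have hcube : ((486 : ℝ) ^ ((1 : ℝ) / 3) * (n : ℝ) ^ ((2 : ℝ) / 3)) ^ 3 = 486 * (n : ℝ) ^ 2 := by
    rw [mul_pow, ← Real.rpow_natCast ((486 : ℝ) ^ ((1 : ℝ) / 3)),
      ← Real.rpow_natCast ((n : ℝ) ^ ((2 : ℝ) / 3)), ← Real.rpow_mul (by norm_num),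
      ← Real.rpow_mul (Nat.cast_nonneg n)]
    norm_num
  have hlt : ((D : ℕ) : ℝ) ^ 3 < ((486 : ℝ) ^ ((1 : ℝ) / 3) * (n : ℝ) ^ ((2 : ℝ) / 3)) ^ 3 := by
    rw [hcube]; exact_mod_cast h
  have hD := lt_of_pow_lt_pow_left₀ 3 hX hlt
  have hsum : (C : ℝ) + D = 6 * n := by exact_mod_cast hCD
  linarith

/-- **Bezdek 2012, Theorem 1.1 (iii), for every `k ≥ 2`** (the venture Prop `OctahedralLowerBound`
of `Statement.lean`, PROVED): `6N − ∛486 · N^{2/3} < C(N)` for `N = k(2k²+1)/3`. The certificate: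
`C ≥ 6N − 6k²` (`le_maxContacts_octahedralNumber`) and `(6k²)³ = 216k⁶ < 486N² = 216k⁶ + 216k⁴ + 54k²`. -/
theorem octahedralLowerBound_holds : OctahedralLowerBound := by
  intro k hk
  obtain ⟨r, rfl⟩ : ∃ r, k = r + 1 := ⟨k - 1, by omega⟩
  set n := octahedralNumber (r + 1) with hn
  have h3n : 3 * n = (r + 1) * (2 * (r + 1) ^ 2 + 1) := by
    rw [hn, octahedralNumber_succ_eq_layerSum, three_mul_octLayerSum]
  have hC := le_maxContacts_octahedralNumber r
  set s := (r + 1) ^ 2 with hs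
  -- the certificate `C + 6k² = 6N`, `(6k²)³ < 486 N²`
  have hCD : 2 * (r * (r + 1) * (2 * r + 1)) + 6 * s = 6 * n := by
    have : 6 * n = 2 * (3 * n) := by ring
    rw [this, h3n, hs]; ring
  have hsq : (3 * n) ^ 2 = s * (2 * s + 1) ^ 2 := by rw [h3n, hs]; ring
  have hcube : (6 * s) ^ 3 < 486 * n ^ 2 := by
    have h9 : 9 * (486 * n ^ 2) = 9 * (6 * s) ^ 3 + (1944 * s ^ 2 + 486 * s) := by
      have : 9 * (486 * n ^ 2) = 486 * (3 * n) ^ 2 := by ring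
      rw [this, hsq]; ring
    have hpos : 0 < 1944 * s ^ 2 + 486 * s := by
      have : 0 < s := by rw [hs]; positivity
      positivity
    exact Nat.lt_of_mul_lt_mul_left (a := 9) (by rw [h9]; exact Nat.lt_add_of_pos_right hpos)
  have hlt := six_mul_sub_rpow_lt_of_cube hCD hcube
  exact hlt.trans_le (by exact_mod_cast hC)

end Summit.Ventures.Crystal3D

end
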